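import Literature.MathematicalPhysics.QuantumFieldTheory.Balaban1983to89.B8Lemma1NonAbelian

/-!
# `Balaban1983to89.B8Thm2LogB` — B8 (1.31): the configuration `B = (1/i) log Ū₁ʲ`, and Theorem 2's bound (1.37) `|B| < 2dLα₁`

CITATION HEADER (lean-in-tree rule 2026-08-18).  Kernel certificate written by the B08 owner lineage
(`b2b-balaban-b08`, generation 22) of the audit cell `pub-balaban` for

* **B8** = T. Bałaban, *Spaces of regular gauge field configurations on a lattice and gauge fixing conditions*,
  Commun. Math. Phys. **99** (1985) 75–102 [cite key `Balaban1985RegularSpaces`; printed page = PDF page + 74;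
  renders READ AS IMAGES: `1985-cmp99-regular-spaces-gauge-fixing-p005/p007/p008/p009-x2.png` = printed pp. 79,
  81, 82, 83],

on top of the non-commutative two-scale model of `B8Lemma1NonAbelian` (gen. 17: the covariant contour product
`covProd` = (1.19), the perturbation `pert` = (1.20), the block offsets `boxVec`, the tree contours `treeWord`) and the
series logarithm `MatrixLog.mlog` of B7 (21).  Nothing in this module is cited FROM the manuscript as a fact: the
displayed formula (1.31) enters only as the DEFINITION of `B` (`Bint`, `crossSum`, `crossMid`, `Bcross` below), and
every `theorem` is kernel-proved — the ABSOLUTE RULE of the cell (no internally-minted statement enters as a cited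
fact; the manuscript under audit is not citable for its own steps).

## The printed texts (verbatim, from the renders)

* p. 79 [PDF 5], (1.19)–(1.20): «(R̄ⁿ_{0,x_{n+1}}Ũ′ⁿ)(Γ_{x_{n+1},x_n}) = Π_{b⊂Γ_{x_{n+1},x_n}} R(Ūⁿ₀(Γ_{x_{n+1},b₋}))Ũ′ⁿ_b
  = 1. (1.19)  Let us recall that the average Ũ′ⁿ was defined in [3] as Ũ′ⁿ = (U′U₀)‾ⁿ(Ūⁿ₀)⁻¹. (1.20)»; and, same
  page, in the proof of Lemma 1: «The condition |V′V₀‾ − V̄₀| = |Ṽ′ − 1| < α₁ implies …».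
* p. 81 [PDF 7]: «The configurations U′ satisfy the equations Ũ′ʲ = V(Ū₀ʲ)⁻¹ on Λ_j, hence U₁ satisfies
  (Ũ₁^{u j})_b = u(b₋)(Ũ₁ʲ)_b R̄ʲ_{0,b} u⁻¹(b₊) = V_b(Ū₀ʲ)_b⁻¹, b ∈ Λ_j. (1.30)» … «In [3] we have determined the
  gauge transformation u in terms of the configuration U₁. We refer the reader especially to the formulas (87),
  (99), (97), and (105) of that paper. If both end-points b₋, b₊ of a bond b belong to Λ_j, then the expression on
  the left-hand side of (1.30) is equal to (Ū₁ʲ)_b by (92) of [3]. If a bond b crosses the boundary of Λ_j, then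
  one of the end-points belongs to Λ_j, e.g. b₊ ∈ Λ_j, and another to Λ_{j−1}, b₋ ∈ Λ_{j−1}. In this case the
  formulas (97), (99), and (87) of [3] imply (Ũ₁^{u j})_b = \overline{R̄^{j−1}_{0,b₋}Ū₁^{j−1}} (Ū₁ʲ)_b = V_b(Ū₀ʲ)_b⁻¹,
  where by the formula (105) of [3] \overline{R̄^{j−1}_{0,b₋}Ū₁^{j−1}} = exp[i Σ_{x∈B(b₋)} L^{−d} (1/i)
  log(R̄^{j−1}_{0,b₋}Ū₁^{j−1})(Γ_{b₋,x})].»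
* p. 82 [PDF 8]: «All sites of the contours Γ_{b₋,x} belong to Λ_{j−1}, hence Ū₁^{j−1} in the above formula is
  equal to V(Ū₀^{j−1})⁻¹. Let us denote V(Ū₀ʲ)⁻¹ = V′. We can write Eq. (1.30) as
  (Ū₁ʲ)_b = V′_b = exp iB_b, if b ⊂ Λ_j (i.e., b₋, b₊ ∈ Λ_j),
  (Ū₁ʲ)_b = exp[−i Σ_{x∈B(b₋)} L^{−d} (1/i) log(R̄^{j−1}_{0,b₋}V′)(Γ_{b₋,x})] V′_b = exp iB_b, if b₋ ∈ Λ_{j−1}, b₊ ∈ Λ_j,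
  (1.31)  or (1/i) log Ū₁ʲ = B on Λ_j, j = 0, 1, …, k, where the configuration B is defined by the above
  equations.»; (1.35): «|(U′U₀)‾ʲ − Ū₀ʲ| < α₁ on Λ_j, j = 0, 1, …, k. (1.35)» … «The condition (1.35) replaces the
  equalities for the averages in the conditions (1.28). It is satisfied if V is close to Ū₀ʲ, more precisely if
  |V − Ū₀ʲ| < α₁.»; and, in the list (1.36)–(1.38) of the conditions on U₁ = U′^{u⁻¹}: «Q_j(U₀, ηA) = B on Λ_j,
  j = 0, 1, …, k, B is given by formula (1.31) with V′ = Ũ′ʲ, |B| < 2dLα₁ by the assumption (1.35), (1.37)».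
* p. 83 [PDF 9]: «Also the condition (1.37) is basically of an algebraic character and it follows from the
  construction, as in (1.30), (1.31). The only fact we need to write it this way is the representation of U₁ and
  the first condition on A in (1.36).» … «Theorem 2. There exist constants B₁, B₂(β₀), c₁ such that for arbitrary
  U₀, U′U₀ satisfying (1.33)–(1.35) with α₀ + α₁ ≦ c₁ there exists exactly one gauge transformation u satisfying
  (1.29) and such that the conditions (1.36)–(1.39) hold for the configuration U₁ = U′^{u⁻¹}.» … (1.42):
  «R(U₀)D^{η*}_{U₀}A = 0, Q_j(U₀, ηA) = B on Λ_j, |B| < 2dLα₁, (1.42)».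

## Dictionary (the model of `B8Lemma1NonAbelian` / `B7Prop1Explicit`, header DICTIONARY there)

The level-`(j−1)` lattice is identified with `ℤ^d` (`Site d`), the level-`j` lattice with its `L`-sublattice; a
block `B(b₋)` is the corner block `{q + boxVec L r : r ∈ (Fin L)^d}` at `q = b₋` read on the fine lattice; the tree
contour `Γ_{b₋,x}`, `x = q + boxVec L r`, is the word `treeWord (boxVec L r)` spelled from `q` (all its letters
forward, `B8Lemma1NonAbelian.forward_of_mem_treeWord`); the gauge group is abstracted to the subgroup
`U1 𝔸 = {u : ‖u‖ ≤ 1, ‖u⁻¹‖ ≤ 1}` of the units of a complete normed `ℂ`-algebra `𝔸` with `‖1‖ = 1` (it contains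
`U(N) ⊂ M_N(ℂ)` and the unitary group of every C⋆-algebra); `log` is the series logarithm `MatrixLog.mlog` of
B7 (21) (domain `|X − 1| < 1`), `exp` is `NormedSpace.exp`, `1/i = I⁻¹`.
* `V₀ : Site d → Fin d → 𝔸ˣ` ↦ `Ū₀^{j−1}`;  `V' : Site d → Fin d → 𝔸ˣ` ↦ the level-`(j−1)` field `V′ = Ũ′^{j−1}`
  on the bonds of `B(b₋)`;  `w : 𝔸ˣ` ↦ the level-`j` bond variable `V′_b = Ũ′ʲ_b`.
* `covProd V₀ V' q (treeWord (boxVec L r))` ↦ `(R̄^{j−1}_{0,b₋}V′)(Γ_{b₋,x})` (the product (1.19)).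
* `Bint w` ↦ `B_b = (1/i) log V′_b` (first line of (1.31));  `crossSum L V₀ V' q` ↦
  `Σ_{x∈B(b₋)} L^{−d} (1/i) log(R̄^{j−1}_{0,b₋}V′)(Γ_{b₋,x})`;  `crossMid L V₀ V' q w` ↦ `exp[−i Σ …] V′_b`;
  `Bcross L V₀ V' q w` ↦ `B_b = (1/i) log(exp[−i Σ …] V′_b)` (second line of (1.31)).
* `BondSmall V' lo hi t` ↦ «`|V′ − 1| ≤ t` on the forward bonds of the box `[lo, hi]`» (here `[q, q + (L−1)𝟙] = B(b₋)`).

## What is certified (kernel, `sorry`-free)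

§1 geometry of the block (`blockTop`, `boxVec_le_blockTop`, `l1_boxVec_le`: `|Γ_{b₋,x}| = |x − b₋|₁ ≤ d(L−1)`).
§2 `norm_covProd_sub_one_le`: along a forward contour of `n` bonds each with `|V′_c − 1| ≤ t` (and `V₀`, `V′`
`U1`-valued) the product (1.19) satisfies `|(R̄V′)(Γ) − 1| ≤ n·t` — conjugations `R(·)` are isometric on `U1`
and `|pq − 1| ≤ |p − 1| + |q − 1|` for `‖p‖ ≤ 1`.  §3 the definitions (1.31) and the sanity identities
`exp(iB_b) = V′_b` (`exp_I_smul_Bint`), `exp(iB_b) = exp[−i Σ …]V′_b` (`exp_I_smul_Bcross`) inside the domain of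
`log`, and `exp[−i Σ_x L^{−d}(1/i) log P_x] = exp(−Σ_x L^{−d} log P_x)` (`neg_I_smul_crossSum`).  §4 the bounds:
`‖Σ‖ ≤ τ/(1 − τ)` with `τ = d(L−1)t` (`norm_crossSum_le`), `‖exp[−iΣ]V′_b − 1‖ ≤ (e^σ − 1) + t`
(`norm_crossMid_sub_one_le`), `‖B_b‖ ≤ u/(1 − u)` (`norm_Bcross_le_div`, `norm_Bint_le_div`), the real
arithmetic `arith137` (`u = e^{τ/(1−τ)} − 1 + a`, `τ = na`, `(n+1)a ≤ 1/8` ⟹ `u < 1` and `u/(1−u) < 2(n+1)a`,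
via `e^σ − 1 ≤ σ + σ²` and the constants `8/7`, `64/49`, `49/41`), and **(1.37)**: `ineq137_interior`,
`ineq137_crossing` — for `d ≥ 1`, `L ≥ 1`, `0 < α₁`, `dLα₁ ≤ 1/8`, `U1`-valued data with `|V′ − 1| ≤ α₁` on the
bonds of `B(b₋)` and `|V′_b − 1| ≤ α₁`: `|B_b| < 2dLα₁` on interior AND crossing bonds; `ineq137_crossing_mirrored`
for the orientation `b₋ ∈ Λ_j, b₊ ∈ Λ_{j−1}` that print leaves to the reader («e.g.»; the mirrored law is
`B8Ineq145.LevelData.crossing_mirrored`, gen. 9).  §5 the link to (1.35): `|Ũ′ʲ_b − 1| = |((U′U₀)‾ʲ_b − Ū₀ʲ_b)(Ū₀ʲ_b)⁻¹|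
≤ |(U′U₀)‾ʲ_b − Ū₀ʲ_b|` for `Ū₀ʲ_b ∈ U1` (`norm_mul_inv_sub_one_le`, `norm_pert_sub_one_le`; in the tower vocabulary
of `B7Prop2Explicit.avgIter`, `smallness_of_ineq135`) — print p. 79 writes this as the equality «|V′V₀‾ − V̄₀| =
|Ṽ′ − 1|» (exact for unitaries) — and the ASSEMBLED statement `ineq137_of_ineq135`: from `U1`-valued averaged data
`U = (U′U₀)‾^{j−1}`, `V₀ = Ū₀^{j−1}` with (1.35) `|U − V₀| ≤ α₁` on the bonds of `B(b₋)`, and `W = (U′U₀)‾ʲ_b`,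
`W₀ = Ū₀ʲ_b` with `|W − W₀| ≤ α₁`, the configuration `B` of (1.31) with `V′ = Ũ′ = pert U V₀`, `Ũ′ʲ_b = W W₀⁻¹`
(1.20) satisfies `|B_b| < 2dLα₁` on both kinds of bonds (`d, L ≥ 1`, `0 < α₁`, `dLα₁ ≤ 1/8`).

So the printed constant `2dL` of (1.37)/(1.42) is now a KERNEL fact of the model: the count behind it is
`|B_b| ≤ (d(L−1) + 1)α₁·(1 + O(dLα₁))` (at most `d(L−1)` contour bonds averaged in the exponent plus the bond `b`
itself), `< 2dLα₁` as soon as `dLα₁ ≤ 1/8`; the hand certificates GAPS C-B8-10 / C-adv4-43 («(π/2)(d(L−1)+1)α₁(1+O(α₁))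
< 2dLα₁», principal logarithm on the unitary group, leading-term engine `B8.ineq137`) are thereby upgraded, with
the series-log bound `|log X| ≤ |X−1|/(1−|X−1|)` (B7 (26), `MatrixLog.norm_mlog_le_div`) in place of `(π/2)|X − 1|`.

## HONEST SCOPE — what is NOT claimed

(i) The two middle EQUALITIES of (1.31) — `(Ū₁ʲ)_b = V′_b` on interior bonds and `(Ū₁ʲ)_b = exp[−i Σ …]V′_b` on
crossing bonds — are B8's reading of B7 (87), (92), (97), (99), (105) applied to (1.29)–(1.30); they are NOT
certified here (their group algebra is `B8Ineq145.LevelData.interior/crossing`, gen. 9, over abstract carriers;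
the averaging formulas of [3] themselves are b07's domain).  `B` enters as DEFINED by the right-hand sides, which
is exactly what (1.37) needs («B is given by formula (1.31) with V′ = Ũ′ʲ»).  (ii) The smallness `dLα₁ ≤ 1/8` is
this file's explicit choice inside print's unspecified «α₀ + α₁ ≦ c₁», `c₁ = c₁(d, L)`; the series logarithm
requires `|X − 1| < 1` at both places where `log` is taken, which the same smallness provides
(`d(L−1)α₁ ≤ 1/8`, `‖exp[−iΣ]V′_b − 1‖ ≤ 8/49`).  (iii) The gauge group is the abstract `U1 𝔸`; for `G = U(N)`
print's `log` (B7 (22)–(23), principal branch) coincides with the series (21) on `|X − 1| < 1`, so nothing is lost,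
but no spectral input (`|log U| ≤ (π/2)|U − 1|`) is used or certified.  (iv) `Q_j(U₀, ηA) = B` (the first half
of the (1.37) line) is the definition of `Q_j` composed with (1.31) and B7 (92) — not typed here (`B8.B137`
keeps it schematic).  (v) Nothing here is progress on the summit `Summit.QuantumFields` — the value is a kernel
section certificate for B8 Sect. B, (1.31)/(1.37).
-/

noncomputable section

open scoped BigOperators
open NormedSpace Finset Complex

namespace Literature.MathematicalPhysics.QuantumFieldTheory.Balaban1983to89.B8Thm2LogB

open B7Prop1Explicit MatrixLog
open B8Lemma1NonAbelian (covProd pert mulCfg boxVec_nonneg forward_of_mem_treeWord disp_nonneg_of_forward e_nonneg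
  norm_units_mul_sub_one_le)

-- `Site` alone would resolve to the torus sites `Balaban1983to89.Site (P : Params) j` of `Setup.lean` (parent
-- namespace beats `open`); re-export the `ℤ^d` sites of `B7Prop1Explicit` into this namespace (as B8Lemma1NonAbelian).
export B7Prop1Explicit (Site)

variable {d : ℕ}

/-! ## §1 The block `B(b₋) = {b₋ + r : 0 ≤ r_μ ≤ L − 1}` and the length of its tree contours -/

/-- The offset of the top corner of a block: `(L−1, …, L−1)`. [folklore] -/
def blockTop (L : ℕ) : Site d := fun _ => (L : ℤ) - 1

/-- `boxVec_le_blockTop` — bookkeeping: every point of `B(q)` lies below the top corner. [folklore] -/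
theorem boxVec_le_blockTop (L : ℕ) (r : Fin d → Fin L) : boxVec L r ≤ blockTop L := fun κ => by
  simp only [boxVec, blockTop]
  have := (r κ).isLt
  omega

/-- `|Γ_{b₋,x}| = |x − b₋|₁ ≤ d(L − 1)` for `x ∈ B(b₋)` — the count behind the constant of (1.37). [folklore] -/
theorem l1_boxVec_le {L : ℕ} (hL : 1 ≤ L) (r : Fin d → Fin L) :
    (l1 (boxVec L r) : ℝ) ≤ d * ((L : ℝ) - 1) := by
  have h : ∀ κ, (((r κ : ℕ) : ℤ)).natAbs ≤ L - 1 := fun κ => by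
    rw [Int.natAbs_natCast]
    have := (r κ).isLt
    omega
  have hs : l1 (boxVec L r) ≤ d * (L - 1) := by
    unfold l1 boxVec
    calc _ ≤ ∑ _κ : Fin d, (L - 1) := Finset.sum_le_sum fun κ _ => h κ
      _ = d * (L - 1) := by simp
  have hc : ((d * (L - 1) : ℕ) : ℝ) = d * ((L : ℝ) - 1) := by
    rw [Nat.cast_mul, Nat.cast_sub hL, Nat.cast_one]
  rw [← hc]
  exact_mod_cast hs

/-! ## §2 The covariant contour product (1.19) of a field close to `1` -/

section CovProd

variable {𝔸 : Type*} [NormedRing 𝔸] [NormOneClass 𝔸]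

/-- «`|V′ − 1| ≤ t`» on the forward bonds `⟨z, z + e_μ⟩` of the box `lo ≤ z`, `z + e_μ ≤ hi`.
[cite: Balaban1985RegularSpaces, (1.35) p.82] -/
def BondSmall (V' : Site d → Fin d → 𝔸ˣ) (lo hi : Site d) (t : ℝ) : Prop :=
  ∀ (z : Site d) (μ : Fin d), lo ≤ z → z + e μ ≤ hi → ‖(V' z μ : 𝔸) - 1‖ ≤ t

omit [NormOneClass 𝔸] in
/-- `BondSmall.mono` — bookkeeping: restriction to a sub-box. [folklore] -/
theorem BondSmall.mono {V' : Site d → Fin d → 𝔸ˣ} {lo hi lo' hi' : Site d} {t : ℝ} (h : BondSmall V' lo hi t)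
    (hlo : lo ≤ lo') (hhi : hi' ≤ hi) : BondSmall V' lo' hi' t :=
  fun z μ hz hzμ => h z μ (hlo.trans hz) (hzμ.trans hhi)

omit [NormOneClass 𝔸] in
/-- `BondSmall.of_le` — bookkeeping: monotonicity in the constant. [folklore] -/
theorem BondSmall.of_le {V' : Site d → Fin d → 𝔸ˣ} {lo hi : Site d} {s t : ℝ} (h : BondSmall V' lo hi s)
    (hst : s ≤ t) : BondSmall V' lo hi t :=
  fun z μ hz hzμ => (h z μ hz hzμ).trans hst

/-- **The product (1.19) of a field close to `1`**: along a contour `Γ` of `n` forward bonds from `x`, each with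
`|V′_c − 1| ≤ t`, and with `V₀`, `V′` taking values in `U1`, `|(R̄(V₀)V′)(Γ) − 1| = |Π_{c⊂Γ} R(V₀(Γ_{x,c₋}))V′_c − 1|
≤ n·t` — each conjugation `R(g)`, `g ∈ U1`, is `1`-Lipschitz about `1` and `|pq − 1| ≤ |p − 1| + |q − 1|` for
`‖p‖ ≤ 1`.  This is the «algebraic character» of (1.37) (p. 83). [cite: Balaban1985RegularSpaces, (1.19) p.79, (1.37) p.82] -/
theorem norm_covProd_sub_one_le (V₀ V' : Site d → Fin d → 𝔸ˣ) (hV₀ : ∀ x κ, V₀ x κ ∈ U1 𝔸)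
    (hV' : ∀ x κ, V' x κ ∈ U1 𝔸) {t : ℝ} (ht : 0 ≤ t) :
    ∀ (x : Site d) (w : List (Letter d)), (∀ l ∈ w, l = (l.1, true)) →
      BondSmall V' x (x + disp w) t → ‖((covProd V₀ V' x w : 𝔸ˣ) : 𝔸) - 1‖ ≤ w.length * t
  | x, [], _, _ => by simp [covProd]
  | x, l :: w, hw, hs => by
    have hl : l = (l.1, true) := hw l (by simp)
    have hw' : ∀ l' ∈ w, l' = (l'.1, true) := fun l' hl' => hw l' (List.mem_cons_of_mem l hl')
    have hvec : l.vec = e l.1 := by rw [hl]; rfl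
    have h0 : ‖(V' x l.1 : 𝔸) - 1‖ ≤ t :=
      hs x l.1 le_rfl (by
        rw [disp_cons, hvec]
        exact add_le_add le_rfl (le_add_of_nonneg_right (disp_nonneg_of_forward hw')))
    have htail : BondSmall V' (x + l.vec) (x + l.vec + disp w) t := fun z μ hz hzμ =>
      hs z μ ((le_add_of_nonneg_right (by rw [hvec]; exact e_nonneg _)).trans hz)
        (by rw [disp_cons, ← add_assoc]; exact hzμ)
    have ih := norm_covProd_sub_one_le V₀ V' hV₀ hV' ht (x + l.vec) w hw' htail
    rw [covProd, List.length_cons, Nat.cast_succ]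
    calc _ ≤ ‖(V' x l.1 : 𝔸) - 1‖
          + ‖((V₀ x l.1 * covProd V₀ V' (x + l.vec) w * (V₀ x l.1)⁻¹ : 𝔸ˣ) : 𝔸) - 1‖ :=
          norm_units_mul_sub_one_le (hV' x l.1)
      _ ≤ t + w.length * t := by
          refine add_le_add h0 ?_
          rw [Units.val_mul, Units.val_mul]
          exact (norm_units_conj_sub_one_le (hV₀ x l.1) _).trans ih
      _ = (w.length + 1) * t := by ring

/-- The tree contour `Γ_{b₋,x}`, `x = b₋ + r ∈ B(b₋)`: `|(R̄(V₀)V′)(Γ_{b₋,x}) − 1| ≤ d(L−1)·t` when `|V′ − 1| ≤ t` on the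
bonds of `B(b₋)`. [cite: Balaban1985RegularSpaces, (1.31) p.82] -/
theorem norm_covProd_treeWord_sub_one_le {L : ℕ} (hL : 1 ≤ L) (V₀ V' : Site d → Fin d → 𝔸ˣ)
    (hV₀ : ∀ x κ, V₀ x κ ∈ U1 𝔸) (hV' : ∀ x κ, V' x κ ∈ U1 𝔸) {t : ℝ} (ht : 0 ≤ t) (q : Site d)
    (hs : BondSmall V' q (q + blockTop L) t) (r : Fin d → Fin L) :
    ‖((covProd V₀ V' q (treeWord (boxVec L r)) : 𝔸ˣ) : 𝔸) - 1‖ ≤ d * ((L : ℝ) - 1) * t := by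
  have h := norm_covProd_sub_one_le V₀ V' hV₀ hV' ht q (treeWord (boxVec L r))
    (fun l hl => forward_of_mem_treeWord (boxVec_nonneg L r) hl)
    (by rw [disp_treeWord]; exact hs.mono le_rfl (add_le_add le_rfl (boxVec_le_blockTop L r)))
  rw [length_treeWord] at h
  exact h.trans (mul_le_mul_of_nonneg_right (l1_boxVec_le hL r) ht)

end CovProd

/-! ## §3 The configuration `B` of (1.31) -/

section SectB

variable {𝔸 : Type*} [NormedRing 𝔸] [NormOneClass 𝔸] [NormedAlgebra ℂ 𝔸] [CompleteSpace 𝔸]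
variable (L : ℕ)

omit [NormOneClass 𝔸] [CompleteSpace 𝔸] in
/-- `‖(1/i)X‖ = ‖X‖` — elementary. [folklore] -/
theorem norm_Iinv_smul (X : 𝔸) : ‖(I⁻¹ • X : 𝔸)‖ = ‖X‖ := by
  rw [norm_smul, norm_inv, Complex.norm_I, inv_one, one_mul]

omit [NormOneClass 𝔸] [CompleteSpace 𝔸] in
/-- `‖(−i)X‖ = ‖X‖` — elementary. [folklore] -/
theorem norm_negI_smul (X : 𝔸) : ‖((-I) • X : 𝔸)‖ = ‖X‖ := by
  rw [norm_smul, norm_neg, Complex.norm_I, one_mul]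

/-- **(1.31), first line** (interior bonds `b ⊂ Λ_j`): `B_b := (1/i) log V′_b`, so that `V′_b = exp iB_b`.
[cite: Balaban1985RegularSpaces, (1.31) p.82] -/
def Bint (w : 𝔸ˣ) : 𝔸 := I⁻¹ • mlog (w : 𝔸)

/-- **(1.31), second line, the exponent sum**: `Σ_{x∈B(b₋)} L^{−d} (1/i) log(R̄^{j−1}_{0,b₋}V′)(Γ_{b₋,x})`, the block
`B(b₋) = {q + r}` read on the `(j−1)`-lattice at `q = b₋`, `(R̄V′)(Γ_{b₋,x})` the product (1.19) = `covProd`.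
[cite: Balaban1985RegularSpaces, (1.31) p.82] -/
def crossSum (V₀ V' : Site d → Fin d → 𝔸ˣ) (q : Site d) : 𝔸 :=
  ∑ r : Fin d → Fin L, (((L : ℝ) ^ d)⁻¹) • (I⁻¹ • mlog ((covProd V₀ V' q (treeWord (boxVec L r)) : 𝔸ˣ) : 𝔸))

/-- **(1.31), second line, middle member**: `exp[−i Σ_{x∈B(b₋)} L^{−d} (1/i) log(R̄^{j−1}_{0,b₋}V′)(Γ_{b₋,x})] V′_b` for a
crossing bond `b₋ ∈ Λ_{j−1}`, `b₊ ∈ Λ_j` (`w = V′_b`). [cite: Balaban1985RegularSpaces, (1.31) p.82] -/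
def crossMid (V₀ V' : Site d → Fin d → 𝔸ˣ) (q : Site d) (w : 𝔸ˣ) : 𝔸 :=
  exp ((-I) • crossSum L V₀ V' q) * (w : 𝔸)

/-- **(1.31), second line** (crossing bonds `b₋ ∈ Λ_{j−1}`, `b₊ ∈ Λ_j`): `B_b := (1/i) log(exp[−i Σ …] V′_b)`, so that
`exp[−i Σ …] V′_b = exp iB_b`. [cite: Balaban1985RegularSpaces, (1.31) p.82] -/
def Bcross (V₀ V' : Site d → Fin d → 𝔸ˣ) (q : Site d) (w : 𝔸ˣ) : 𝔸 :=
  I⁻¹ • mlog (crossMid L V₀ V' q w)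

/-- The MIRRORED crossing bond `b₋ ∈ Λ_j`, `b₊ ∈ Λ_{j−1}` (print's «e.g.» leaves it to the reader; the law
`Ũ′ʲ_b = Ū₁ʲ_b · R̄ʲ_{0,b}(F(b₊))⁻¹` is `B8Ineq145.LevelData.crossing_mirrored`): `B_b := (1/i) log(V′_b · R(g) exp[+i Σ_{b₊}])`
with `g = Ū₀ʲ_b`. [folklore] -/
def BcrossMirror (V₀ V' : Site d → Fin d → 𝔸ˣ) (q : Site d) (g w : 𝔸ˣ) : 𝔸 :=
  I⁻¹ • mlog ((w : 𝔸) * ((g : 𝔸) * exp (I • crossSum L V₀ V' q) * ((g⁻¹ : 𝔸ˣ) : 𝔸)))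

omit [NormOneClass 𝔸] in
/-- **(1.31), first line, as an identity**: `exp iB_b = V′_b` (inside the domain `|V′_b − 1| < 1` of `log`).
[cite: Balaban1985RegularSpaces, (1.31) p.82] -/
theorem exp_I_smul_Bint {w : 𝔸ˣ} (hw : ‖(w : 𝔸) - 1‖ < 1) : exp (I • Bint w) = (w : 𝔸) := by
  rw [Bint, smul_smul, mul_inv_cancel₀ I_ne_zero, one_smul, exp_mlog hw]

omit [NormOneClass 𝔸] in
/-- **(1.31), second line, as an identity**: `exp iB_b = exp[−i Σ …] V′_b` (inside the domain of `log`).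
[cite: Balaban1985RegularSpaces, (1.31) p.82] -/
theorem exp_I_smul_Bcross (V₀ V' : Site d → Fin d → 𝔸ˣ) (q : Site d) {w : 𝔸ˣ}
    (hw : ‖crossMid L V₀ V' q w - 1‖ < 1) : exp (I • Bcross L V₀ V' q w) = crossMid L V₀ V' q w := by
  rw [Bcross, smul_smul, mul_inv_cancel₀ I_ne_zero, one_smul, exp_mlog hw]

omit [NormOneClass 𝔸] [CompleteSpace 𝔸] in
/-- `−i · Σ_x L^{−d} (1/i) log P_x = − Σ_x L^{−d} log P_x`: the exponential factor of (1.31) is the INVERSE of the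
block exp-mean-log `\overline{R̄^{j−1}_{0,b₋}V′} = exp[Σ_x L^{−d} log P_x]` of B7 (105). [cite: Balaban1985RegularSpaces, (1.31) p.82] -/
theorem neg_I_smul_crossSum (V₀ V' : Site d → Fin d → 𝔸ˣ) (q : Site d) :
    (-I) • crossSum L V₀ V' q
      = -∑ r : Fin d → Fin L, (((L : ℝ) ^ d)⁻¹) • mlog ((covProd V₀ V' q (treeWord (boxVec L r)) : 𝔸ˣ) : 𝔸) := by
  rw [crossSum, Finset.smul_sum, ← Finset.sum_neg_distrib]
  refine Finset.sum_congr rfl fun r _ => ?_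
  rw [smul_comm, smul_smul, neg_mul, mul_inv_cancel₀ I_ne_zero, neg_one_smul, smul_neg]

/-! ## §4 The bound (1.37) `|B| < 2dLα₁` -/

omit [NormOneClass 𝔸] in
/-- Interior bonds: `|B_b| = |log V′_b| ≤ |V′_b − 1|/(1 − |V′_b − 1|)` (B7 (26)). [cite: Balaban1985RegularSpaces, (1.37) p.82] -/
theorem norm_Bint_le_div {w : 𝔸ˣ} {t : ℝ} (hw : ‖(w : 𝔸) - 1‖ ≤ t) (ht : t < 1) :
    ‖Bint w‖ ≤ t / (1 - t) := by
  rw [Bint, norm_Iinv_smul]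
  have hw1 : ‖(w : 𝔸) - 1‖ < 1 := hw.trans_lt ht
  refine (norm_mlog_le_div hw1).trans ?_
  exact div_le_div₀ ((norm_nonneg _).trans hw) hw (by linarith) (by linarith)

/-- The exponent sum of (1.31): `‖Σ_{x∈B(b₋)} L^{−d}(1/i) log(R̄V′)(Γ_{b₋,x})‖ ≤ τ/(1 − τ)`, `τ = d(L−1)t`, when
`|V′ − 1| ≤ t` on the bonds of `B(b₋)` and `τ < 1` (a convex combination of logarithms of products within `τ` of `1`).
[cite: Balaban1985RegularSpaces, (1.31) p.82, (1.37) p.82] -/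
theorem norm_crossSum_le (hL : 1 ≤ L) (V₀ V' : Site d → Fin d → 𝔸ˣ) (hV₀ : ∀ x κ, V₀ x κ ∈ U1 𝔸)
    (hV' : ∀ x κ, V' x κ ∈ U1 𝔸) (q : Site d) {t : ℝ} (ht : 0 ≤ t) (hs : BondSmall V' q (q + blockTop L) t)
    (hτ : d * ((L : ℝ) - 1) * t < 1) :
    ‖crossSum L V₀ V' q‖ ≤ d * ((L : ℝ) - 1) * t / (1 - d * ((L : ℝ) - 1) * t) := by
  unfold crossSum
  refine norm_avg_le L hL _ fun r => ?_
  rw [norm_Iinv_smul]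
  have hP := norm_covProd_treeWord_sub_one_le hL V₀ V' hV₀ hV' ht q hs r
  have hP1 : ‖((covProd V₀ V' q (treeWord (boxVec L r)) : 𝔸ˣ) : 𝔸) - 1‖ < 1 := hP.trans_lt hτ
  refine (norm_mlog_le_div hP1).trans ?_
  exact div_le_div₀ ((norm_nonneg _).trans hP) hP (by linarith) (by linarith)

omit [NormOneClass 𝔸] in
/-- The middle member of (1.31): `‖exp[−iΣ]V′_b − 1‖ ≤ (e^σ − 1) + |V′_b − 1|` for `‖Σ‖ ≤ σ`, `‖V′_b‖ ≤ 1`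
(`exp[−iΣ]V′_b − 1 = (exp[−iΣ] − 1)V′_b + (V′_b − 1)`). [cite: Balaban1985RegularSpaces, (1.31) p.82, (1.37) p.82] -/
theorem norm_crossMid_sub_one_le (V₀ V' : Site d → Fin d → 𝔸ˣ) (q : Site d) {σ t : ℝ}
    (hS : ‖crossSum L V₀ V' q‖ ≤ σ) {w : 𝔸ˣ} (hw1 : ‖(w : 𝔸)‖ ≤ 1) (hw : ‖(w : 𝔸) - 1‖ ≤ t) :
    ‖crossMid L V₀ V' q w - 1‖ ≤ (Real.exp σ - 1) + t := by
  have hσ0 : 0 ≤ Real.exp σ - 1 := by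
    have := Real.add_one_le_exp σ
    linarith [(norm_nonneg _).trans hS]
  have hE : ‖exp ((-I) • crossSum L V₀ V' q) - 1‖ ≤ Real.exp σ - 1 :=
    B7Transfer.norm_exp_sub_one_le_of_le _ (by rwa [norm_negI_smul])
  have hsplit : crossMid L V₀ V' q w - 1
      = (exp ((-I) • crossSum L V₀ V' q) - 1) * (w : 𝔸) + ((w : 𝔸) - 1) := by
    unfold crossMid; noncomm_ring
  rw [hsplit]
  calc _ ≤ ‖(exp ((-I) • crossSum L V₀ V' q) - 1) * (w : 𝔸)‖ + ‖(w : 𝔸) - 1‖ := norm_add_le _ _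
    _ ≤ ‖exp ((-I) • crossSum L V₀ V' q) - 1‖ * ‖(w : 𝔸)‖ + t := add_le_add (norm_mul_le _ _) hw
    _ ≤ (Real.exp σ - 1) * 1 + t := by gcongr
    _ = (Real.exp σ - 1) + t := by rw [mul_one]

omit [NormOneClass 𝔸] in
/-- Crossing bonds: `|B_b| = |log(exp[−iΣ]V′_b)| ≤ u/(1 − u)` once `‖exp[−iΣ]V′_b − 1‖ ≤ u < 1` (B7 (26)).
[cite: Balaban1985RegularSpaces, (1.37) p.82] -/
theorem norm_Bcross_le_div (V₀ V' : Site d → Fin d → 𝔸ˣ) (q : Site d) {w : 𝔸ˣ} {u : ℝ}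
    (hmid : ‖crossMid L V₀ V' q w - 1‖ ≤ u) (hu : u < 1) : ‖Bcross L V₀ V' q w‖ ≤ u / (1 - u) := by
  rw [Bcross, norm_Iinv_smul]
  have h1 : ‖crossMid L V₀ V' q w - 1‖ < 1 := hmid.trans_lt hu
  refine (norm_mlog_le_div h1).trans ?_
  exact div_le_div₀ ((norm_nonneg _).trans hmid) hmid (by linarith) (by linarith)

/-- The real arithmetic of (1.37): with `τ = na`, `σ = τ/(1 − τ)`, `u = e^σ − 1 + a` and `(n + 1)a ≤ 1/8`:
`u < 1` and `u/(1 − u) < 2(n + 1)a`.  (Chain: `τ ≤ 1/8`, `σ ≤ (8/7)τ ≤ 1/7`, `e^σ − 1 ≤ σ + σ² ≤ (64/49)τ`,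
`u ≤ (64/49)(n+1)a ≤ 8/49`, `u/(1−u) ≤ (49/41)u ≤ (64/41)(n+1)a < 2(n+1)a`.) [folklore] -/
theorem arith137 {n a : ℝ} (hn : 0 ≤ n) (ha : 0 < a) (h : (n + 1) * a ≤ 1 / 8) :
    Real.exp (n * a / (1 - n * a)) - 1 + a < 1 ∧
      (Real.exp (n * a / (1 - n * a)) - 1 + a) / (1 - (Real.exp (n * a / (1 - n * a)) - 1 + a))
        < 2 * ((n + 1) * a) := by
  set τ := n * a with hτdef
  have hτ0 : 0 ≤ τ := by positivity
  have hτ : τ ≤ 1 / 8 := by nlinarith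
  set σ := τ / (1 - τ) with hσdef
  have hσ0 : 0 ≤ σ := div_nonneg hτ0 (by linarith)
  have hσ : σ ≤ 8 / 7 * τ := by
    rw [hσdef, div_le_iff₀ (by linarith)]
    nlinarith
  have hσ1 : σ ≤ 1 := by linarith
  have hexp : Real.exp σ - 1 ≤ σ + σ ^ 2 := by
    have := expRem_le_sq hσ0 hσ1
    unfold expRem at this
    linarith
  have hexp' : Real.exp σ - 1 ≤ 64 / 49 * τ := by nlinarith
  set u := Real.exp σ - 1 + a with hudef
  have hu : u ≤ 64 / 49 * ((n + 1) * a) := by nlinarith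
  have hu1 : u ≤ 8 / 49 := by linarith
  refine ⟨by linarith, ?_⟩
  rw [div_lt_iff₀ (by linarith)]
  nlinarith [mul_pos (by norm_num : (0 : ℝ) < 18 / 49) (mul_pos (by linarith : (0 : ℝ) < n + 1) ha)]

omit [NormOneClass 𝔸] in
/-- **(1.37) on interior bonds** `b ⊂ Λ_j`: `|V′_b − 1| ≤ α₁`, `0 < α₁`, `dLα₁ ≤ 1/8` (`d, L ≥ 1`) ⟹
`|B_b| = |(1/i) log V′_b| < 2dLα₁` (indeed `≤ α₁/(1 − α₁) < 2α₁`). [cite: Balaban1985RegularSpaces, (1.37) p.82] -/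
theorem ineq137_interior (hd : 1 ≤ d) (hL : 1 ≤ L) {α₁ : ℝ} (hα : 0 < α₁)
    (hsmall : (d : ℝ) * L * α₁ ≤ 1 / 8) {w : 𝔸ˣ} (hw : ‖(w : 𝔸) - 1‖ ≤ α₁) :
    ‖Bint w‖ < 2 * d * L * α₁ := by
  have hd' : (1 : ℝ) ≤ d := by exact_mod_cast hd
  have hL' : (1 : ℝ) ≤ L := by exact_mod_cast hL
  have hdL : (1 : ℝ) ≤ (d : ℝ) * L := by nlinarith
  have hα8 : α₁ ≤ 1 / 8 := by nlinarith
  refine (norm_Bint_le_div hw (by linarith)).trans_lt ?_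
  rw [div_lt_iff₀ (by linarith)]
  nlinarith [mul_pos hα hα, mul_nonneg (sub_nonneg.2 hdL) hα.le]

/-- **(1.37) on crossing bonds** `b₋ ∈ Λ_{j−1}`, `b₊ ∈ Λ_j` — «|B| < 2dLα₁ by the assumption (1.35)»: if `V₀ = Ū₀^{j−1}`
and `V′ = Ũ′^{j−1}` take values in `U1`, `|V′ − 1| ≤ α₁` on the bonds of the block `B(b₋)` («All sites of the contours
Γ_{b₋,x} belong to Λ_{j−1}»), the level-`j` bond variable `V′_b ∈ U1` has `|V′_b − 1| ≤ α₁`, `0 < α₁` and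
`dLα₁ ≤ 1/8` (`d, L ≥ 1`), then `|B_b| = |(1/i) log(exp[−i Σ_{x∈B(b₋)} L^{−d}(1/i) log(R̄^{j−1}_{0,b₋}V′)(Γ_{b₋,x})] V′_b)|
< 2dLα₁`.  The count: at most `d(L−1)` contour bonds in the averaged exponent plus the bond `b`, `(d(L−1)+1)α₁(1 +
O(dLα₁)) < 2dLα₁`. [cite: Balaban1985RegularSpaces, (1.37) p.82, (1.42) p.83] -/
theorem ineq137_crossing (hd : 1 ≤ d) (hL : 1 ≤ L) {α₁ : ℝ} (hα : 0 < α₁)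
    (hsmall : (d : ℝ) * L * α₁ ≤ 1 / 8) (V₀ V' : Site d → Fin d → 𝔸ˣ) (hV₀ : ∀ x κ, V₀ x κ ∈ U1 𝔸)
    (hV' : ∀ x κ, V' x κ ∈ U1 𝔸) (q : Site d) (hs : BondSmall V' q (q + blockTop L) α₁)
    {w : 𝔸ˣ} (hw1 : w ∈ U1 𝔸) (hw : ‖(w : 𝔸) - 1‖ ≤ α₁) :
    ‖Bcross L V₀ V' q w‖ < 2 * d * L * α₁ := by
  have hd' : (1 : ℝ) ≤ d := by exact_mod_cast hd
  have hL' : (1 : ℝ) ≤ L := by exact_mod_cast hL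
  set n : ℝ := d * ((L : ℝ) - 1) with hndef
  have hn : 0 ≤ n := by rw [hndef]; nlinarith
  have hn1 : (n + 1) * α₁ ≤ (d : ℝ) * L * α₁ := by
    rw [hndef]
    nlinarith
  have hA := arith137 hn hα (hn1.trans hsmall)
  have hτ : n * α₁ < 1 := by nlinarith
  have hS := norm_crossSum_le L hL V₀ V' hV₀ hV' q hα.le hs (by rw [← hndef]; exact hτ)
  rw [← hndef] at hS
  have hmid := norm_crossMid_sub_one_le L V₀ V' q hS (mem_U1.mp hw1).1 hw
  have hB := norm_Bcross_le_div L V₀ V' q hmid hA.1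
  refine hB.trans_lt (hA.2.trans_le ?_)
  nlinarith

/-- Mirrored crossing bonds: `‖V′_b · R(g)exp[+iΣ] − 1‖ ≤ |V′_b − 1| + (e^σ − 1)` for `‖Σ‖ ≤ σ`, `‖V′_b‖ ≤ 1`, `g ∈ U1`.
[folklore] -/
theorem norm_mirrorMid_sub_one_le (V₀ V' : Site d → Fin d → 𝔸ˣ) (q : Site d) {σ t : ℝ}
    (hS : ‖crossSum L V₀ V' q‖ ≤ σ) {g w : 𝔸ˣ} (hg : g ∈ U1 𝔸) (hw1 : ‖(w : 𝔸)‖ ≤ 1)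
    (hw : ‖(w : 𝔸) - 1‖ ≤ t) :
    ‖(w : 𝔸) * ((g : 𝔸) * exp (I • crossSum L V₀ V' q) * ((g⁻¹ : 𝔸ˣ) : 𝔸)) - 1‖ ≤ t + (Real.exp σ - 1) := by
  have hE : ‖exp (I • crossSum L V₀ V' q) - 1‖ ≤ Real.exp σ - 1 :=
    B7Transfer.norm_exp_sub_one_le_of_le _ (by rwa [norm_smul, Complex.norm_I, one_mul])
  have hC : ‖(g : 𝔸) * exp (I • crossSum L V₀ V' q) * ((g⁻¹ : 𝔸ˣ) : 𝔸) - 1‖ ≤ Real.exp σ - 1 :=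
    (norm_units_conj_sub_one_le hg _).trans hE
  exact (B8Ineq170.norm_mul_sub_one_le_of_norm_le_one hw1).trans (add_le_add hw hC)

/-- **(1.37) on the mirrored crossing bonds** `b₋ ∈ Λ_j`, `b₊ ∈ Λ_{j−1}` (print: «e.g.»): the same hypotheses at the
block `B(b₊)` and `g = Ū₀ʲ_b ∈ U1` give `|B_b| = |(1/i) log(V′_b · R(g) exp[+iΣ_{b₊}])| < 2dLα₁`. [folklore] -/
theorem ineq137_crossing_mirrored (hd : 1 ≤ d) (hL : 1 ≤ L) {α₁ : ℝ} (hα : 0 < α₁)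
    (hsmall : (d : ℝ) * L * α₁ ≤ 1 / 8) (V₀ V' : Site d → Fin d → 𝔸ˣ) (hV₀ : ∀ x κ, V₀ x κ ∈ U1 𝔸)
    (hV' : ∀ x κ, V' x κ ∈ U1 𝔸) (q : Site d) (hs : BondSmall V' q (q + blockTop L) α₁)
    {g w : 𝔸ˣ} (hg : g ∈ U1 𝔸) (hw1 : w ∈ U1 𝔸) (hw : ‖(w : 𝔸) - 1‖ ≤ α₁) :
    ‖BcrossMirror L V₀ V' q g w‖ < 2 * d * L * α₁ := by
  have hd' : (1 : ℝ) ≤ d := by exact_mod_cast hd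
  have hL' : (1 : ℝ) ≤ L := by exact_mod_cast hL
  set n : ℝ := d * ((L : ℝ) - 1) with hndef
  have hn : 0 ≤ n := by rw [hndef]; nlinarith
  have hn1 : (n + 1) * α₁ ≤ (d : ℝ) * L * α₁ := by
    rw [hndef]
    nlinarith
  have hA := arith137 hn hα (hn1.trans hsmall)
  have hτ : n * α₁ < 1 := by nlinarith
  have hS := norm_crossSum_le L hL V₀ V' hV₀ hV' q hα.le hs (by rw [← hndef]; exact hτ)
  rw [← hndef] at hS
  have hmid := norm_mirrorMid_sub_one_le L V₀ V' q hS hg (mem_U1.mp hw1).1 hw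
  rw [add_comm] at hmid
  have h1 : ‖(w : 𝔸) * ((g : 𝔸) * exp (I • crossSum L V₀ V' q) * ((g⁻¹ : 𝔸ˣ) : 𝔸)) - 1‖ < 1 :=
    hmid.trans_lt hA.1
  have hB : ‖BcrossMirror L V₀ V' q g w‖
      ≤ (Real.exp (n * α₁ / (1 - n * α₁)) - 1 + α₁) / (1 - (Real.exp (n * α₁ / (1 - n * α₁)) - 1 + α₁)) := by
    rw [BcrossMirror, norm_Iinv_smul]
    refine (norm_mlog_le_div h1).trans ?_
    exact div_le_div₀ ((norm_nonneg _).trans hmid) hmid (by linarith [hA.1]) (by linarith)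
  refine hB.trans_lt (hA.2.trans_le ?_)
  nlinarith

/-! ## §5 The hypothesis: (1.35) and (1.20) give `|V′ − 1| ≤ α₁` -/

omit [NormedAlgebra ℂ 𝔸] [CompleteSpace 𝔸] in
/-- `|W·W₀⁻¹ − 1| = |(W − W₀)W₀⁻¹| ≤ |W − W₀|` for `W₀ ∈ U1` — elementary. [folklore] -/
theorem norm_mul_inv_sub_one_le (W : 𝔸ˣ) {W₀ : 𝔸ˣ} (h₀ : W₀ ∈ U1 𝔸) :
    ‖((W * W₀⁻¹ : 𝔸ˣ) : 𝔸) - 1‖ ≤ ‖(W : 𝔸) - (W₀ : 𝔸)‖ := by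
  have he : ((W * W₀⁻¹ : 𝔸ˣ) : 𝔸) - 1 = ((W : 𝔸) - (W₀ : 𝔸)) * ((W₀⁻¹ : 𝔸ˣ) : 𝔸) := by
    rw [Units.val_mul, sub_mul, Units.mul_inv]
  rw [he]
  calc _ ≤ ‖(W : 𝔸) - (W₀ : 𝔸)‖ * ‖((W₀⁻¹ : 𝔸ˣ) : 𝔸)‖ := norm_mul_le _ _
    _ ≤ ‖(W : 𝔸) - (W₀ : 𝔸)‖ * 1 := by gcongr; exact h₀.2
    _ = _ := mul_one _

omit [NormedAlgebra ℂ 𝔸] [CompleteSpace 𝔸] in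
/-- (1.20) `Ũ′ʲ = (U′U₀)‾ʲ(Ū₀ʲ)⁻¹` and (1.35) `|(U′U₀)‾ʲ − Ū₀ʲ| < α₁`: `|Ũ′ʲ_b − 1| = |((U′U₀)‾ʲ_b − Ū₀ʲ_b)(Ū₀ʲ_b)⁻¹|
≤ |(U′U₀)‾ʲ_b − Ū₀ʲ_b|` for `Ū₀ʲ_b ∈ U1` (p. 79: «|V′V₀‾ − V̄₀| = |Ṽ′ − 1|», an equality for unitaries).
[cite: Balaban1985RegularSpaces, (1.20) p.79, (1.35) p.82] -/
theorem norm_pert_sub_one_le (W W₀ : Site d → Fin d → 𝔸ˣ) (x : Site d) (μ : Fin d) (h₀ : W₀ x μ ∈ U1 𝔸) :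
    ‖((pert W W₀ x μ : 𝔸ˣ) : 𝔸) - 1‖ ≤ ‖(W x μ : 𝔸) - (W₀ x μ : 𝔸)‖ :=
  norm_mul_inv_sub_one_le (W x μ) h₀

/-- In the tower vocabulary of `B7Prop2Explicit.avgIter` (`Ūʲ = avgIter L U j`, every level identified with `ℤ^d`):
(1.35) at a level-`j` bond, `|(U′U₀)‾ʲ_b − Ū₀ʲ_b| ≤ α₁` with `Ū₀ʲ_b ∈ U1`, gives `|Ũ′ʲ_b − 1| ≤ α₁` for
`Ũ′ʲ = pert (avgIter L (U′U₀) j) (avgIter L U₀ j)` (1.20) — the hypothesis `hw` / `BondSmall` of `ineq137_*`.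
[cite: Balaban1985RegularSpaces, (1.20) p.79, (1.35) p.82, (1.37) p.82] -/
theorem smallness_of_ineq135 (U' U₀ : Site d → Fin d → 𝔸ˣ) (j : ℕ) (x : Site d) (μ : Fin d) {α₁ : ℝ}
    (h₀ : B7Prop2Explicit.avgIter L U₀ j x μ ∈ U1 𝔸)
    (h135 : ‖(B7Prop2Explicit.avgIter L (mulCfg U' U₀) j x μ : 𝔸) - (B7Prop2Explicit.avgIter L U₀ j x μ : 𝔸)‖ ≤ α₁) :
    ‖((pert (B7Prop2Explicit.avgIter L (mulCfg U' U₀) j) (B7Prop2Explicit.avgIter L U₀ j) x μ : 𝔸ˣ) : 𝔸) - 1‖ ≤ α₁ :=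
  (norm_pert_sub_one_le _ _ x μ h₀).trans h135

omit [NormedAlgebra ℂ 𝔸] [CompleteSpace 𝔸] in
/-- `pert U V₀ = U·V₀⁻¹` of `U1`-valued fields is `U1`-valued (subgroup). [folklore] -/
theorem pert_mem {U V₀ : Site d → Fin d → 𝔸ˣ} (hU : ∀ x κ, U x κ ∈ U1 𝔸) (hV₀ : ∀ x κ, V₀ x κ ∈ U1 𝔸)
    (x : Site d) (κ : Fin d) : pert U V₀ x κ ∈ U1 𝔸 :=
  (U1 𝔸).mul_mem (hU x κ) ((U1 𝔸).inv_mem (hV₀ x κ))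

/-- **Theorem 2, condition (1.37), from the assumption (1.35)** — «B is given by formula (1.31) with V′ = Ũ′ʲ,
|B| < 2dLα₁ by the assumption (1.35)», assembled in the model.  DATA: at level `j − 1`, on the block `B(b₋)`
(corner `q = b₋`), the averaged fields `U = (U′U₀)‾^{j−1}` and `V₀ = Ū₀^{j−1}`, `U1`-valued, with (1.35)
`|U_c − (V₀)_c| ≤ α₁` on the bonds `c` of `B(b₋)`; at the level-`j` bond `b`, the averaged variables `W = (U′U₀)‾ʲ_b`,
`W₀ = Ū₀ʲ_b ∈ U1` with (1.35) `|W − W₀| ≤ α₁`; `V′ = Ũ′ = pert U V₀` and `Ũ′ʲ_b = W·W₀⁻¹` by (1.20); `d, L ≥ 1`,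
`0 < α₁`, `dLα₁ ≤ 1/8`.  CONCLUSION: `|B_b| < 2dLα₁` for `B_b` given by EITHER line of (1.31) (interior bond:
`(1/i) log Ũ′ʲ_b`; crossing bond: `(1/i) log(exp[−iΣ_{x∈B(b₋)} L^{−d}(1/i) log(R̄^{j−1}_{0,b₋}Ũ′^{j−1})(Γ_{b₋,x})] Ũ′ʲ_b)`).
[cite: Balaban1985RegularSpaces, (1.35) p.82, (1.37) p.82, Theorem 2 p.83] -/
theorem ineq137_of_ineq135 (hd : 1 ≤ d) (hL : 1 ≤ L) {α₁ : ℝ} (hα : 0 < α₁)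
    (hsmall : (d : ℝ) * L * α₁ ≤ 1 / 8) (U V₀ : Site d → Fin d → 𝔸ˣ) (hU : ∀ x κ, U x κ ∈ U1 𝔸)
    (hV₀ : ∀ x κ, V₀ x κ ∈ U1 𝔸) (q : Site d)
    (h135 : ∀ (z : Site d) (μ : Fin d), q ≤ z → z + e μ ≤ q + blockTop L → ‖(U z μ : 𝔸) - (V₀ z μ : 𝔸)‖ ≤ α₁)
    {W W₀ : 𝔸ˣ} (hW : W ∈ U1 𝔸) (hW₀ : W₀ ∈ U1 𝔸) (h135b : ‖(W : 𝔸) - (W₀ : 𝔸)‖ ≤ α₁) :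
    ‖Bint (W * W₀⁻¹)‖ < 2 * d * L * α₁ ∧ ‖Bcross L V₀ (pert U V₀) q (W * W₀⁻¹)‖ < 2 * d * L * α₁ := by
  have hw1 : W * W₀⁻¹ ∈ U1 𝔸 := (U1 𝔸).mul_mem hW ((U1 𝔸).inv_mem hW₀)
  have hw : ‖((W * W₀⁻¹ : 𝔸ˣ) : 𝔸) - 1‖ ≤ α₁ := (norm_mul_inv_sub_one_le W hW₀).trans h135b
  have hs : BondSmall (pert U V₀) q (q + blockTop L) α₁ := fun z μ hz hzμ =>
    (norm_pert_sub_one_le U V₀ z μ (hV₀ z μ)).trans (h135 z μ hz hzμ)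
  exact ⟨ineq137_interior L hd hL hα hsmall hw,
    ineq137_crossing L hd hL hα hsmall V₀ (pert U V₀) hV₀ (pert_mem hU hV₀) q hs hw1 hw⟩

end SectB

#print axioms norm_covProd_sub_one_le
#print axioms arith137
#print axioms ineq137_interior
#print axioms ineq137_crossing
#print axioms ineq137_crossing_mirrored
#print axioms ineq137_of_ineq135

end Literature.MathematicalPhysics.QuantumFieldTheory.Balaban1983to89.B8Thm2LogB

end
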